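import Literature.AlgebraicGeometry.Hyperkaehler.LooijengaLuntsVerbitsky
import Literature.AlgebraicGeometry.Hyperkaehler.GeneralizedKummerType
import Literature.AlgebraicGeometry.HodgeTheory.RationalHodgeClasses
import HarnessLib

/-!
# LLV-trivial middle classes of a `Kumⁿ`-type variety are of Hodge type `(n, n)` (Verbitsky; Green–Kim–Laza–Robles Prop. 21) — NAMED FACT

Layer `Literature/AlgebraicGeometry/Hyperkaehler`.  CITE record for the cell `hodge-kum4` (ladder
HodgeAV, rung H3: the Hodge conjecture for every smooth projective variety of `Kum⁴`-type; cell home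
run/shared/lean/pub/hodge-kum4/; seat p2's leaf A4b "the `𝒦`-classes are of type `(4,4)`" of crux I,
STATUS 2026-08-25T19:37Z: p2 proves in the kernel that the `Γ`-coinvariant middle classes are killed by
the LLV algebra and needs «LLV-trivial ⇒ `(p,p)`» as the print input).

## The printed result and its one-line consequence recorded here

For a compact hyper-Kähler manifold `X` of dimension `2n`, the Looijenga–Lunts–Verbitsky Lie algebra
`g = g_tot(X) ⊂ gl(H*(X, ℚ))` (generated by the Lefschetz operators `L_x` and dual Lefschetz operators
`Λ_x`, tree: `Hyperkaehler.llvAlgebra`) CONTAINS THE WEIL (HODGE) OPERATOR of every complex structure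
of hyper-Kähler type on `X`:

* M. Green, Y.-J. Kim, R. Laza, C. Robles, *The LLV decomposition of hyper-Kähler cohomology*,
  Math. Ann. 382 (2022) (arXiv:1906.03432) [`GreenKimLazaRobles2022`; REFEREED], §2.2.1, arXiv p. 11,
  verbatim: "Assuming a complex structure on `X` was fixed, we obtain a second operator
  `f ∈ gl(H*(X, ℝ))` defined by `f : x ↦ (q-p)√-1 x` for `x ∈ H^{p,q}(X)`, capturing the Hodge
  structure of the cohomology. […] **Proposition 21.** The operator `f ∈ gl(H*(X, ℝ))` in
  (eq:hodge_operator) is contained in `ḡ_ℝ` as a semisimple element.  *Proof.* Fix a hyper-Kähler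
  metric `g` on `X` inducing the twistor complex structures `I, J, K` with `I` being the original
  complex structure of `X` […] Let `L_I, L_J, L_K` be the Lefschetz operators and `Λ_I, Λ_J, Λ_K` the
  dual Lefschetz operators associated to them. […] Verbitsky [ver90] showed that
  `f = -[L_J, Λ_K] = -[L_K, Λ_J]` on `H*(X, ℝ)`.  Thus, `f` is contained in `g_ℝ` by Definition
  (def_llv)."; and §1, arXiv p. 4: "the trivial representations in `H*(Kum_n)` (and thus universal
  Hodge cycles of middle dimension)"; Remark 33 (arXiv p. 17, after Cor. 32
  `H*(Kum₄) = ⋯ ⊕ ℝ^{⊕625} ⊕ ⋯`): "Geometrically, this means that a variety of `Kum_n` type contains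
  many Hodge cycles (of order `n⁴`) even if it is non-projective."
* N. Kurnosov, A. Soldatenkov, M. Verbitsky, *Kuga–Satake construction and cohomology of hyperkähler
  manifolds*, Adv. Math. 351 (2019) (arXiv:1703.07477) [`KurnosovSoldatenkovVerbitsky2019KugaSatake`;
  REFEREED], §1 (arXiv p. 4) verbatim: "An important property of the Lie algebra
  `g_tot(M) ≅ so(4, b₂(M)-2)` acting on cohomology of a hyperkähler manifold is that it contains the
  Weil operators `W_I` for all complex structures of hyperkähler type on `M` […] the Weil operator
  `W_I ∈ End(H•(M))` acts on `H^{p,q}(M)` as `√-1(p-q)`.  This implies that the Hodge structure on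
  `H•(M, ℂ)` is induced by the action of `g_tot(M)`", and §5.2 (arXiv p. 13): "In fact, one has
  `[L_I, Λ_J] = W_K`, `[L_J, Λ_K] = W_I`, `[L_I, Λ_K] = -W_J` ([so(5)])" — M. Verbitsky, Funct. Anal.
  Appl. 24 (1990) [`Verbitsky1990SO5`].

CONSEQUENCE (the statement recorded): if `v ∈ H^{2n}(X; ℂ)` is annihilated by the (complexified)
LLV algebra — `v` spans a trivial sub-representation, GKLR's summands `ℝ^{⊕625}` for `Kum₄` — then in
particular `W_I v = 0`; writing `v = Σ v^{p,q}` in the Hodge decomposition of `H^{2n}(X; ℂ)`,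
`W_I v = Σ √-1(p-q) v^{p,q} = 0` forces `v^{p,q} = 0` for `p ≠ q`, i.e. `v ∈ H^{n,n}(X)`: **`v` is of
Hodge type `(n, n)`** — GKLR's "trivial representations … (universal) Hodge cycles of middle
dimension".  (That a `g`-trivial class lives in the middle degree is the tree's
`Hyperkaehler.IsLLVTrivial.degreeOperator_apply`; here `v` is taken in `H^{2n}` from the start.)

## Rendering (tree carriers) and faithfulness

* `X` smooth projective over `ℂ` of dimension `2n` and of `Kumⁿ`-type
  (`Motives.IsSmoothProjective (2 * n) X`, `IsOfGeneralizedKummerType n X`): then `X(ℂ)` is a compact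
  hyper-Kähler manifold of dimension `2n` (a deformation of Beauville's `Kⁿ(A)`), the scope of the
  printed statements (which hold for every compact hyper-Kähler manifold; the cell needs `Kumⁿ`, and
  the tree has no general "hyper-Kähler type" predicate — `TODO(general form)`: K3^[n], OG6, OG10 types
  alike).
* "annihilated by the LLV algebra": `Hyperkaehler.IsLLVTrivial ℂ X(ℂ) (2n) v` for the image
  `ofDegree … (2n) v` of `v ∈ H^{2n}(X(ℂ); ℂ)` in the total cohomology `⨁ₖ Hᵏ(X(ℂ); ℂ)`
  (`Hyperkaehler/LooijengaLuntsVerbitsky`: `g_tot(X(ℂ); ℂ)` is the Lie subalgebra of `gl(H*(X(ℂ); ℂ))`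
  generated by the `L_a`, `Λ` over all `sl(2)`-triples `(L_a, h, Λ)`, `a ∈ H²(X(ℂ); ℂ)`).  With COMPLEX
  coefficients this algebra contains `L_{ω_J} ⊗ 1`, `Λ_{ω_K} ⊗ 1` for the (real) Kähler classes
  `ω_J, ω_K` of the twistor complex structures (they have the Lefschetz property on the graded space
  `H*(X)`), hence Verbitsky's `W_I = [L_J, Λ_K]`; so the hypothesis "killed by `g_tot(X(ℂ); ℂ)`" implies
  `W_I v = 0`, which is all the consequence uses — the complex-coefficient hypothesis is (if anything)
  STRONGER than "killed by `g_tot(X; ℚ) ⊗ ℂ`", so nothing stronger than print is asserted.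
* "of Hodge type `(n, n)`": `HodgeTheory.IsOfHodgeType (2n) X (2n) n n v` (`HodgeTheory/RationalHodgeClasses`:
  in some — equivalently, by `hodgePQ_independent_of_hodgeModel_holds`, any — Hodge model of `X` the
  pull-back of `v` lies in `H^{n,n}`).
* NOT asserted: the LLV decomposition itself (GKLR Cor. 32), `g ≅ so(4, b₂-2)`, the number `625`,
  anything about `ḡ`-invariant classes in other degrees, or the converse.

## Content

* NAMED FACT `GreenKimLazaRobles2022_llvTrivial_isOfHodgeType_kumType` (all `n`);
* PROVED specialisation `.kum4Type` (`n = 4`: degree `8`, type `(4, 4)` — the literal shape of the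
  consumer, seat p2's `𝒦 ⊂ H⁸(X(ℂ); ℂ)`).
-/

noncomputable section

open Literature.AlgebraicTopology.SingularHomology

namespace Literature.AlgebraicGeometry.Hyperkaehler

/-- **LLV-trivial middle classes are of Hodge type `(n, n)` (Verbitsky 1990; Green–Kim–Laza–Robles
2022, Prop. 21 and §1/Rem. 33; Kurnosov–Soldatenkov–Verbitsky 2019, §1).**  For `X` smooth projective
over `ℂ` of dimension `2n` and of `Kumⁿ`-type, and `v ∈ H^{2n}(X(ℂ); ℂ)` annihilated by the
Looijenga–Lunts–Verbitsky algebra `g_tot(X(ℂ); ℂ)` (`IsLLVTrivial`: `v` spans a trivial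
sub-representation — GKLR's "trivial representations in `H*(Kum_n)` (and thus universal Hodge cycles
of middle dimension)"), `v` is of Hodge type `(n, n)`.  Mechanism in print: `g_tot` contains the Weil
operator `W_I = [L_J, Λ_K]` (acting by `√-1(p-q)` on `H^{p,q}`) of the complex structure of `X`
(GKLR Prop. 21 after Verbitsky; KSV §1: "the Hodge structure on `H•(M, ℂ)` is induced by the action
of `g_tot(M)`"), so `W_I v = 0` and `v ∈ H^{n,n}`.  A THEOREM in print (REFEREED: Math. Ann. 2022,
Adv. Math. 2019; unproved in the tree). [cite: GreenKimLazaRobles2022, Prop. 21 (§2.2.1, arXiv p. 11: f = -[L_J, Λ_K] ∈ ḡ_ℝ) with §1 p. 4 and Rem. 33 (trivial representations = universal Hodge cycles of middle dimension)]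
[cite: KurnosovSoldatenkovVerbitsky2019KugaSatake, §1 (arXiv p. 4: g_tot(M) contains the Weil operators W_I) and §5.2 ([L_J, Λ_K] = W_I)]
[cite: Verbitsky1990SO5, the so(5)-action (Weil operators as commutators of Lefschetz operators)] -/
def GreenKimLazaRobles2022_llvTrivial_isOfHodgeType_kumType : Prop :=
  ∀ (n : ℕ) ⦃X : Motives.SchemeOver ℂ⦄, Motives.IsSmoothProjective (2 * n) X →
    IsOfGeneralizedKummerType n X →
      ∀ v : singularCohomology ℂ ℂ (Motives.ComplexPoints X) (2 * n),
        IsLLVTrivial ℂ (Motives.ComplexPoints X) (2 * n)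
            (ofDegree ℂ (Motives.ComplexPoints X) (2 * n) v) →
          HodgeTheory.IsOfHodgeType (2 * n) X (2 * n) n n v

namespace GreenKimLazaRobles2022_llvTrivial_isOfHodgeType_kumType

/-- **`Kum⁴`-type (`n = 4`), literal shape of the consumer**: for `X` smooth projective of dimension
`8` of `Kum⁴`-type, every `v ∈ H⁸(X(ℂ); ℂ)` killed by `g_tot(X(ℂ); ℂ)` (in "complex dimension" `8`) is
of Hodge type `(4, 4)`. [cite: GreenKimLazaRobles2022, Prop. 21 with §1 p. 4 / Rem. 33 (Kum₄: ℝ^{⊕625} ⊂ H⁸)] -/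
theorem kum4Type (h : GreenKimLazaRobles2022_llvTrivial_isOfHodgeType_kumType)
    {X : Motives.SchemeOver ℂ} (hX : Motives.IsSmoothProjective 8 X)
    (hK : IsOfGeneralizedKummerType 4 X) (v : singularCohomology ℂ ℂ (Motives.ComplexPoints X) 8)
    (hv : IsLLVTrivial ℂ (Motives.ComplexPoints X) 8 (ofDegree ℂ (Motives.ComplexPoints X) 8 v)) :
    HodgeTheory.IsOfHodgeType 8 X 8 4 4 v :=
  h 4 hX hK v hv

end GreenKimLazaRobles2022_llvTrivial_isOfHodgeType_kumType

end Literature.AlgebraicGeometry.Hyperkaehler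

end
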